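import Literature.Topology.FourManifolds.BasinSaturation
import HarnessLib

/-!
# The basin setting: the global level conjugation `psi` (conj on the domain, identity elsewhere)

Topic `Literature/Topology/FourManifolds`; seventh file of the endgame of the Torelli half of
Griffiths' handlebody theorem.  Everything here is **proved**.

For `B : BasinSetting g ξ` and a self-map `χ` of `∂W`:
* `BasinSetting.psi χ` — `conj χ` on the domain, the identity off it: level-preserving, inverted
  by `psi χ'` for a left inverse `χ'` (`psi_psi_of_leftInverse`), the identity on the
  trajectories whose boundary point is fixed (`psi_eq_self_of_top_not_mem`);
* `BasinSetting.sat K m` — the moving saturation below `m` of a set `K ⊆ ∂W`; its closure lies in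
  `dom ∪ {p₀}` for `K` compact in the basin (`BasinSaturation.lean`), so that
* `contMDiffAt_psi` — **`psi` of a smooth `χ` which is the identity off a compact `K ⊆ ∂W ∩ basin`
  and preserves the traces is smooth at every point of `{g < m}` other than `p₀`** (`m < hi`).

## References

* J. Milnor, *Lectures on the h-cobordism theorem*, notes by L. Siebenmann and J. Sondow,
  Princeton Mathematical Notes (1965): Def. 3.1, proof of Thm. 3.4 (PDF pp. 11–13), Def. 3.9
  (PDF p. 16), Thm. 4.1 (PDF p. 22), proof of Thm. 5.4, Assertion 4 (PDF p. 29).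
  [MilnorHCobordism1965]
* J. Milnor, *Morse theory* (1963), Thm. 3.1 and proof of Thm. 4.1 (p. 25). [Milnor1963]
* H. B. Griffiths, *Automorphisms of a 3-dimensional handlebody*, Abh. Math. Sem. Univ. Hamburg
  26 (1964), §§3–6. [GriffithsHB1964Handlebody]
-/

open scoped Manifold ContDiff Topology
open Set Function Filter Metric

noncomputable section

namespace Literature.Topology.FourManifolds

open Cobordism FourManifolds.Flow

universe u

variable {n : ℕ} {W : Type u} [TopologicalSpace W] [T2Space W] [SecondCountableTopology W]
  [CompactSpace W] [ChartedSpace (EuclideanHalfSpace (n + 1)) W] [IsManifold (𝓡∂ (n + 1)) ∞ W]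

/-! ### The global level conjugation `Ψ₀`: conj on the domain, the identity elsewhere -/

namespace BasinSetting

variable {g : W → ℝ} {ξ : Π x : W, TangentSpace (𝓡∂ (n + 1)) x} (B : BasinSetting g ξ)
variable [Nonempty (BoundaryManifold.boundaryData n W).carrier]

open scoped Classical in
/-- **The global level conjugation** of a self-map `χ` of `∂W`: the level conjugation `conj χ`
on the domain, the identity off it. [cite: GriffithsHB1964Handlebody, §§3–6] -/
def psi (χ : (𝓡∂ (n + 1)).boundary W → (𝓡∂ (n + 1)).boundary W) (x : W) : W :=
  if x ∈ B.dom then B.conj χ x else x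

variable {B}
variable {χ χ' : (𝓡∂ (n + 1)).boundary W → (𝓡∂ (n + 1)).boundary W}

/-- `psi` on the domain. [folklore] -/
theorem psi_of_mem (χ : (𝓡∂ (n + 1)).boundary W → (𝓡∂ (n + 1)).boundary W) {x : W} (hx : x ∈ B.dom) :
    B.psi χ x = B.conj χ x := by
  unfold psi; rw [if_pos hx]

/-- `psi` off the domain. [folklore] -/
theorem psi_of_not_mem (χ : (𝓡∂ (n + 1)).boundary W → (𝓡∂ (n + 1)).boundary W) {x : W}
    (hx : x ∉ B.dom) : B.psi χ x = x := by
  unfold psi; rw [if_neg hx]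

/-- `psi` fixes `p₀`. [folklore] -/
theorem psi_p₀ (χ : (𝓡∂ (n + 1)).boundary W → (𝓡∂ (n + 1)).boundary W) : B.psi χ B.p₀ = B.p₀ :=
  psi_of_not_mem χ fun h => ne_p₀_of_mem_dom h rfl

/-- **`psi` preserves the levels** (for `χ` preserving the traces). [cite: GriffithsHB1964Handlebody, §§3–6] -/
theorem apply_psi (hχ : ∀ y, χ y ∈ B.traces ↔ y ∈ B.traces) (x : W) : g (B.psi χ x) = g x := by
  by_cases hx : x ∈ B.dom
  · rw [psi_of_mem χ hx, apply_conj hχ hx]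
  · rw [psi_of_not_mem χ hx]

/-- `psi` maps the domain to itself and its complement to itself. [folklore] -/
theorem psi_mem_dom_iff (hχ : ∀ y, χ y ∈ B.traces ↔ y ∈ B.traces) (x : W) :
    B.psi χ x ∈ B.dom ↔ x ∈ B.dom := by
  by_cases hx : x ∈ B.dom
  · rw [psi_of_mem χ hx]; exact ⟨fun _ => hx, fun _ => conj_mem_dom hχ hx⟩
  · rw [psi_of_not_mem χ hx]

/-- **`psi χ'` inverts `psi χ` when `χ' ∘ χ = id`.** [cite: GriffithsHB1964Handlebody, §§3–6] -/
theorem psi_psi_of_leftInverse (h : LeftInverse χ' χ) (hχ : ∀ y, χ y ∈ B.traces ↔ y ∈ B.traces)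
    (x : W) : B.psi χ' (B.psi χ x) = x := by
  by_cases hx : x ∈ B.dom
  · rw [psi_of_mem χ hx, psi_of_mem χ' (conj_mem_dom hχ hx), conj_conj_of_leftInverse h hχ hx]
  · rw [psi_of_not_mem χ hx, psi_of_not_mem χ' hx]

/-- **`psi` is the identity on the trajectories whose boundary point is fixed by `χ`**: if `χ`
is the identity off a set `K ⊆ ∂W` and the top of `x ∈ dom` is not the push of a point of `K`,
then `psi χ x = x`. [folklore] -/
theorem psi_eq_self_of_top_not_mem {K : Set ((𝓡∂ (n + 1)).boundary W)} (hχK : ∀ y, y ∉ K → χ y = y)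
    {x : W} (hx : B.top x ∉ (fun y : (𝓡∂ (n + 1)).boundary W => B.push (y : W)) '' K) :
    B.psi χ x = x := by
  by_cases hxd : x ∈ B.dom
  · rw [psi_of_mem χ hxd]
    refine conj_eq_self hxd (hχK _ fun hK => hx ?_)
    refine ⟨B.bret (B.top x), hK, ?_⟩
    show B.push (B.bret (B.top x) : W) = B.top x
    rw [B.coe_bret (by rw [apply_top_of_mem_dom hxd]; exact B.one_sub_a'_lt_L.le),
      B.push_ret_of_apply_eq_L (apply_top_of_mem_dom hxd)]
  · exact psi_of_not_mem χ hxd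

variable (B)

/-- **The moving saturation** of a set `K ⊆ ∂W` below the level `m`: the points of the domain
below `m` whose top is the push of a point of `K`. [folklore] -/
def sat (K : Set ((𝓡∂ (n + 1)).boundary W)) (m : ℝ) : Set W :=
  {x | x ∈ B.dom ∧ g x ≤ m ∧ B.top x ∈ (fun y : (𝓡∂ (n + 1)).boundary W => B.push (y : W)) '' K}

omit [Nonempty (BoundaryManifold.boundaryData n W).carrier] in
/-- The push of a compact `K ⊆ ∂W ∩ basin` is a compact subset of `L ∩ basin`. [folklore] -/
theorem isCompact_push_image {K : Set ((𝓡∂ (n + 1)).boundary W)} (hK : IsCompact K) :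
    IsCompact ((fun y : (𝓡∂ (n + 1)).boundary W => B.push (y : W)) '' K) :=
  hK.image (B.contMDiff_push.continuous.comp continuous_subtype_val)

omit [Nonempty (BoundaryManifold.boundaryData n W).carrier] in
/-- The closure of the moving saturation of a compact `K ⊆ ∂W ∩ basin` below `m < hi` lies in
`dom ∪ {p₀}`. [cite: MilnorHCobordism1965, Thm. 4.1 (PDF p. 22)] -/
theorem closure_sat_subset' {K : Set ((𝓡∂ (n + 1)).boundary W)} (hK : IsCompact K)
    (hKb : ∀ y ∈ K, (y : W) ∈ B.basin) {m : ℝ} (hm : m < B.hi) :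
    closure (B.sat K m) ⊆ B.dom ∪ {B.p₀} := by
  refine B.closure_sat_subset (B.isCompact_push_image hK) ?_ ?_ hm
  · rintro _ ⟨y, hy, rfl⟩
    rw [mem_basin_iff, ← B.coe_mem_unstableSet_iff]; exact hKb y hy
  · rintro _ ⟨y, -, rfl⟩; exact B.apply_push_coe y

variable {B}

/-- **`psi` is the identity off the closure of the moving saturation, below `m`.** [folklore] -/
theorem psi_eq_self_of_not_mem_closure_sat {K : Set ((𝓡∂ (n + 1)).boundary W)}
    (hχK : ∀ y, y ∉ K → χ y = y) {m : ℝ} {x : W} (hxm : g x ≤ m) (hx : x ∉ closure (B.sat K m)) :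
    B.psi χ x = x := by
  by_cases hxd : x ∈ B.dom
  · refine psi_eq_self_of_top_not_mem hχK fun htop => hx (subset_closure ⟨hxd, hxm, htop⟩)
  · exact psi_of_not_mem χ hxd

/-- **`psi` of a smooth `χ`, the identity off a compact `K ⊆ ∂W ∩ basin` and preserving the
traces, is smooth at every point of `{g < m}` other than `p₀`** (`m < hi`): on the domain it
is the smooth level conjugation; a point of `{g < m} ∖ {p₀}` off the domain lies off the closure
of the moving saturation, an open set on which `psi` is the identity.
[cite: GriffithsHB1964Handlebody, §§3–6] [cite: MilnorHCobordism1965, Thm. 4.1 (PDF p. 22)] -/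
theorem contMDiffAt_psi (hχs : ContMDiff (𝓡 n) (𝓡 n) ∞ χ) (hχ : ∀ y, χ y ∈ B.traces ↔ y ∈ B.traces)
    {K : Set ((𝓡∂ (n + 1)).boundary W)} (hK : IsCompact K) (hKb : ∀ y ∈ K, (y : W) ∈ B.basin)
    (hχK : ∀ y, y ∉ K → χ y = y) {m : ℝ} (hm : m < B.hi) {x : W} (hxm : g x < m) (hxp : x ≠ B.p₀) :
    ContMDiffAt (𝓡∂ (n + 1)) (𝓡∂ (n + 1)) ∞ (B.psi χ) x := by
  by_cases hxd : x ∈ B.dom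
  · refine (B.contMDiffAt_conj hχs hχ hxd).congr_of_eventuallyEq ?_
    filter_upwards [B.isOpen_dom.mem_nhds hxd] with z hz
    exact psi_of_mem χ hz
  · have hxc : x ∉ closure (B.sat K m) := fun h => by
      rcases B.closure_sat_subset' hK hKb hm h with h' | h'
      · exact hxd h'
      · exact hxp h'
    have hO : (closure (B.sat K m))ᶜ ∩ {z : W | g z < m} ∈ 𝓝 x :=
      Filter.inter_mem (isClosed_closure.isOpen_compl.mem_nhds hxc)
        ((isOpen_lt B.isMorseFunction.isMorse.contMDiff.continuous continuous_const).mem_nhds hxm)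
    refine contMDiffAt_id.congr_of_eventuallyEq ?_
    filter_upwards [hO] with z hz
    exact psi_eq_self_of_not_mem_closure_sat hχK (le_of_lt hz.2) hz.1

end BasinSetting

end Literature.Topology.FourManifolds
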